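import Summits.QuantumFields.YangMills.Theorems.LuscherReductionTwistedTraceScalingToronSlowModes
import Summits.QuantumFields.YangMills.Theorems.LuscherReductionTwistedTraceScalingToronValleyStep
import Literature.Analysis.OperatorTheory.GaussianTransferKernelWindow
import HarnessLib

/-!
# C3b-BO: the Born–Oppenheimer form of the fattened harmonic valley step at `V_θ` — exact on the FAST (stiff) window with both gains, the nine SLOW (constant,
# one-site) coordinates left as an explicit kernel integral against an arbitrary slow weight
# (VALLEY/INNER of S-BASE, crux `TwistedTraceScaling` stmt-QuantumFields-20203; design `pub/ym-fleet/ym-luscher-20007-p1/COARSE-DESIGN.md` §14)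

For an eigenframe `(eᵢ, aᵢ = ‖D_θeᵢ‖²)` of `‖D_{V_θ}·‖²` adapted to `slowModes θ` (`…ToronSlowModes.exists_isDiag_adapted_slowModes`), fast window
`W = {i | eᵢ ∉ slowModes θ}`, `t ≥ 0`, `b > 0`, `0 ≤ ε < 1`, Riccati exponents `cⱼ = √((taⱼ)²+2taⱼb)` on `W`, and any slow weight `g ≥ 0`:
`∫ e^{−t‖D_θx‖²}e^{−b‖x−y‖²}e^{−t‖D_θy‖²}·e^{−Σ_W(1−ε)cⱼ⟪eⱼ,y⟫²}·g(slow(y)) dy`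
`  ≤ (√(1−ε))^{−|W|}·√(π/b)^{|W|}·e^{−[2·toronZPE L (t/b) 0 0 + 4·restZPE L (t/b) (2θ)]}·e^{−(ε/2)tΣ_W aⱼ⟪eⱼ,x⟫²}·e^{−Σ_W(1−ε)cⱼ⟪eⱼ,x⟫²}·`
`    ∫_slow e^{−Σ_slow taⱼ⟪eⱼ,x⟫²}e^{−bΣ_slow(⟪eⱼ,x⟫−wⱼ)²}e^{−Σ_slow taⱼwⱼ²} g(w) dw`
(★★★ `valleyModelStepBO_le`).  Ingredients: `Literature.…GaussianTransferKernelWindow.integral_gaussKernel_mul_gaussian_window`, the fast zero-point sum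
`sum_modeZPE_fast_of_adapted`, `gainRate_ge`, `sqrt_pi_div_fat_le`, `prod_sqrt_pi_div_eq`.  The slow integral is the harmonic (at `V_θ`: quadratic) shadow of the
one-site transfer kernel at `B' = L³β`; replacing it by the EXACT one-site kernel is the sandwich's job (lane B H4 / successor).

HONEST FRAMING: Gaussian calculus at fixed `L`; femto rung R2b1 (brick for a stub of a child of a CONDITIONAL route); not a gap, not Clay.
-/

set_option autoImplicit false

noncomputable section

open Finset MeasureTheory
open scoped BigOperators InnerProductSpace RealInnerProductSpace Classical
open Literature.MathematicalPhysics.QuantumFieldTheory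
open Literature.MathematicalPhysics.QuantumLattice
open Literature.Analysis.OperatorTheory.GaussianTransferKernel

namespace Summit.QuantumFields.YangMills.Theorems.FemtoTransferGap.TwoLattice.Toron

open Summit.QuantumFields.YangMills.Theorems.FemtoTransferGap
open Summit.QuantumFields.YangMills.Theorems.FemtoTransferGap.TwoLattice.Cov
open Summit.QuantumFields.YangMills.Theorems.FemtoTransferGap.TwoLattice.Stiff

variable (L : ℕ) [NeZero L]

/-- ★★★ **BORN–OPPENHEIMER FATTENED VALLEY STEP at `V_θ`** (see the module docstring for the formula). [cite: Wipf2021, §8.5.2 (8.64)–(8.67)]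
[cite: Luscher1983, §3] -/
theorem valleyModelStepBO_le (θ : Fin 3 → ℝ) {n : ℕ} {e : OrthonormalBasis (Fin n) ℝ (LinkSpace L)}
    (h : Frame.IsDiag (covCurl (abelianCfg L θ)) e (fun i => ‖covCurl (abelianCfg L θ) (e i)‖ ^ 2))
    (hadapt : ∀ i, e i ∈ slowModes L θ ∨ e i ∈ (slowModes L θ)ᗮ) {t b ε : ℝ} (ht : 0 ≤ t) (hb : 0 < b) (hε0 : 0 ≤ ε) (hε1 : ε < 1)
    {g : ({i : Fin n // ¬ e i ∉ slowModes L θ} → ℝ) → ℝ} (hg : ∀ w, 0 ≤ g w) (x : LinkSpace L) :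
    ∫ y, Real.exp (-(t * ‖covCurl (abelianCfg L θ) x‖ ^ 2)) * Real.exp (-(b * ‖x - y‖ ^ 2)) * Real.exp (-(t * ‖covCurl (abelianCfg L θ) y‖ ^ 2)) *
        (Real.exp (-(∑ j : {i : Fin n // e i ∉ slowModes L θ}, (1 - ε) * riccati (t * ‖covCurl (abelianCfg L θ) (e j)‖ ^ 2) b * ⟪e (j : Fin n), y⟫ ^ 2)) *
          g (fun j => ⟪e (j : Fin n), y⟫)) ≤
      (Real.sqrt (1 - ε))⁻¹ ^ Fintype.card {i : Fin n // e i ∉ slowModes L θ} * Real.sqrt (Real.pi / b) ^ Fintype.card {i : Fin n // e i ∉ slowModes L θ} *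
          Real.exp (-(2 * toronZPE L (t / b) 0 0 + 4 * restZPE L (t / b) (fun k => 2 * θ k))) *
        Real.exp (-(ε / 2 * t * ∑ j : {i : Fin n // e i ∉ slowModes L θ}, ‖covCurl (abelianCfg L θ) (e j)‖ ^ 2 * ⟪e (j : Fin n), x⟫ ^ 2)) *
        Real.exp (-(∑ j : {i : Fin n // e i ∉ slowModes L θ}, (1 - ε) * riccati (t * ‖covCurl (abelianCfg L θ) (e j)‖ ^ 2) b * ⟪e (j : Fin n), x⟫ ^ 2)) *
        ∫ w : {i : Fin n // ¬ e i ∉ slowModes L θ} → ℝ,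
          Real.exp (-(∑ j : {i : Fin n // ¬ e i ∉ slowModes L θ}, t * ‖covCurl (abelianCfg L θ) (e j)‖ ^ 2 * ⟪e (j : Fin n), x⟫ ^ 2)) *
          Real.exp (-(b * ∑ j : {i : Fin n // ¬ e i ∉ slowModes L θ}, (⟪e (j : Fin n), x⟫ - w j) ^ 2)) *
          Real.exp (-(∑ j : {i : Fin n // ¬ e i ∉ slowModes L θ}, t * ‖covCurl (abelianCfg L θ) (e j)‖ ^ 2 * w j ^ 2)) * g w := by
  have ha0 : ∀ i : Fin n, 0 ≤ t * ‖covCurl (abelianCfg L θ) (e i)‖ ^ 2 := fun i => mul_nonneg ht (by positivity)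
  have hc0 : ∀ j : {i : Fin n // e i ∉ slowModes L θ}, 0 ≤ (1 - ε) * riccati (t * ‖covCurl (abelianCfg L θ) (e j)‖ ^ 2) b :=
    fun j => mul_nonneg (by linarith) (riccati_nonneg _ _)
  -- the kernel in the frame (pointwise, so that the Riccati exponents are untouched)
  have hD : ∀ z : LinkSpace L, t * ‖covCurl (abelianCfg L θ) z‖ ^ 2 = ∑ i, t * ‖covCurl (abelianCfg L θ) (e i)‖ ^ 2 * ⟪e i, z⟫ ^ 2 := fun z => by
    rw [h.norm_sq_eq_sum_real z, mul_sum]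
    exact sum_congr rfl fun i _ => by ring
  have hpt : ∀ y : LinkSpace L,
      Real.exp (-(t * ‖covCurl (abelianCfg L θ) x‖ ^ 2)) * Real.exp (-(b * ‖x - y‖ ^ 2)) * Real.exp (-(t * ‖covCurl (abelianCfg L θ) y‖ ^ 2)) *
        (Real.exp (-(∑ j : {i : Fin n // e i ∉ slowModes L θ}, (1 - ε) * riccati (t * ‖covCurl (abelianCfg L θ) (e j)‖ ^ 2) b * ⟪e (j : Fin n), y⟫ ^ 2)) *
          g (fun j => ⟪e (j : Fin n), y⟫)) =
      Real.exp (-(∑ i, t * ‖covCurl (abelianCfg L θ) (e i)‖ ^ 2 * ⟪e i, x⟫ ^ 2)) * Real.exp (-(b * ‖x - y‖ ^ 2)) *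
        Real.exp (-(∑ i, t * ‖covCurl (abelianCfg L θ) (e i)‖ ^ 2 * ⟪e i, y⟫ ^ 2)) *
        (Real.exp (-(∑ j : {i : Fin n // e i ∉ slowModes L θ}, (1 - ε) * riccati (t * ‖covCurl (abelianCfg L θ) (e j)‖ ^ 2) b * ⟪e (j : Fin n), y⟫ ^ 2)) *
          g (fun j => ⟪e (j : Fin n), y⟫)) := fun y => by rw [hD x, hD y]
  simp_rw [hpt]
  rw [integral_gaussKernel_mul_gaussian_window e (fun i => e i ∉ slowModes L θ) ha0 hb hc0 g x]
  -- the fast zero-point sum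
  have hZ : ∑ j : {i : Fin n // e i ∉ slowModes L θ}, modeZPE (t * ‖covCurl (abelianCfg L θ) (e j)‖ ^ 2 / b) =
      2 * toronZPE L (t / b) 0 0 + 4 * restZPE L (t / b) (fun k => 2 * θ k) := by
    rw [← sum_modeZPE_fast_of_adapted L θ h hadapt (t / b)]
    exact sum_congr rfl fun j _ => by rw [div_mul_eq_mul_div]
  -- (1) the fast prefactor
  have hP : ∏ j : {i : Fin n // e i ∉ slowModes L θ}, Real.sqrt (Real.pi / (t * ‖covCurl (abelianCfg L θ) (e j)‖ ^ 2 + b + (1 - ε) * riccati (t * ‖covCurl (abelianCfg L θ) (e j)‖ ^ 2) b)) ≤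
      (Real.sqrt (1 - ε))⁻¹ ^ Fintype.card {i : Fin n // e i ∉ slowModes L θ} * Real.sqrt (Real.pi / b) ^ Fintype.card {i : Fin n // e i ∉ slowModes L θ} *
        Real.exp (-(2 * toronZPE L (t / b) 0 0 + 4 * restZPE L (t / b) (fun k => 2 * θ k))) := by
    calc ∏ j : {i : Fin n // e i ∉ slowModes L θ}, Real.sqrt (Real.pi / (t * ‖covCurl (abelianCfg L θ) (e j)‖ ^ 2 + b + (1 - ε) * riccati (t * ‖covCurl (abelianCfg L θ) (e j)‖ ^ 2) b))
        ≤ ∏ j : {i : Fin n // e i ∉ slowModes L θ}, ((Real.sqrt (1 - ε))⁻¹ * Real.sqrt (Real.pi / (t * ‖covCurl (abelianCfg L θ) (e j)‖ ^ 2 + b + riccati (t * ‖covCurl (abelianCfg L θ) (e j)‖ ^ 2) b))) :=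
          prod_le_prod (fun j _ => Real.sqrt_nonneg _) fun j _ => sqrt_pi_div_fat_le (ha0 j) hb hε0 hε1
      _ = (Real.sqrt (1 - ε))⁻¹ ^ Fintype.card {i : Fin n // e i ∉ slowModes L θ} * (Real.sqrt (Real.pi / b) ^ Fintype.card {i : Fin n // e i ∉ slowModes L θ} *
            Real.exp (-∑ j : {i : Fin n // e i ∉ slowModes L θ}, modeZPE (t * ‖covCurl (abelianCfg L θ) (e j)‖ ^ 2 / b))) := by
          rw [prod_mul_distrib, prod_const, card_univ,
            prod_sqrt_pi_div_eq (fun j : {i : Fin n // e i ∉ slowModes L θ} => ha0 j) hb (fun j => riccati_nonneg _ _) (fun j => riccati_sq (ha0 j) hb.le)]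
      _ = _ := by rw [hZ, mul_assoc]
  -- (2) the fast Gaussian gain
  have hG : Real.exp (-(∑ j : {i : Fin n // e i ∉ slowModes L θ}, ((t * ‖covCurl (abelianCfg L θ) (e j)‖ ^ 2) ^ 2 + 2 * (t * ‖covCurl (abelianCfg L θ) (e j)‖ ^ 2) * b -
        ((1 - ε) * riccati (t * ‖covCurl (abelianCfg L θ) (e j)‖ ^ 2) b) ^ 2) / (t * ‖covCurl (abelianCfg L θ) (e j)‖ ^ 2 + b + (1 - ε) * riccati (t * ‖covCurl (abelianCfg L θ) (e j)‖ ^ 2) b) * ⟪e (j : Fin n), x⟫ ^ 2)) ≤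
      Real.exp (-(ε / 2 * t * ∑ j : {i : Fin n // e i ∉ slowModes L θ}, ‖covCurl (abelianCfg L θ) (e j)‖ ^ 2 * ⟪e (j : Fin n), x⟫ ^ 2)) := by
    refine Real.exp_le_exp.mpr (neg_le_neg ?_)
    rw [mul_sum]
    refine sum_le_sum fun j _ => ?_
    have := gainRate_ge (ha0 j) hb hε0 hε1.le
    calc ε / 2 * t * (‖covCurl (abelianCfg L θ) (e j)‖ ^ 2 * ⟪e (j : Fin n), x⟫ ^ 2) = ε / 2 * (t * ‖covCurl (abelianCfg L θ) (e j)‖ ^ 2) * ⟪e (j : Fin n), x⟫ ^ 2 := by ring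
      _ ≤ _ := mul_le_mul_of_nonneg_right this (sq_nonneg _)
  -- (3) the slow integral is non-negative
  have hS : 0 ≤ ∫ w : {i : Fin n // ¬ e i ∉ slowModes L θ} → ℝ,
      Real.exp (-(∑ j : {i : Fin n // ¬ e i ∉ slowModes L θ}, t * ‖covCurl (abelianCfg L θ) (e j)‖ ^ 2 * ⟪e (j : Fin n), x⟫ ^ 2)) *
      Real.exp (-(b * ∑ j : {i : Fin n // ¬ e i ∉ slowModes L θ}, (⟪e (j : Fin n), x⟫ - w j) ^ 2)) *
      Real.exp (-(∑ j : {i : Fin n // ¬ e i ∉ slowModes L θ}, t * ‖covCurl (abelianCfg L θ) (e j)‖ ^ 2 * w j ^ 2)) * g w :=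
    integral_nonneg fun w => mul_nonneg (by positivity) (hg w)
  calc _ ≤ ((Real.sqrt (1 - ε))⁻¹ ^ Fintype.card {i : Fin n // e i ∉ slowModes L θ} * Real.sqrt (Real.pi / b) ^ Fintype.card {i : Fin n // e i ∉ slowModes L θ} *
          Real.exp (-(2 * toronZPE L (t / b) 0 0 + 4 * restZPE L (t / b) (fun k => 2 * θ k))) *
          Real.exp (-(ε / 2 * t * ∑ j : {i : Fin n // e i ∉ slowModes L θ}, ‖covCurl (abelianCfg L θ) (e j)‖ ^ 2 * ⟪e (j : Fin n), x⟫ ^ 2)) *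
          Real.exp (-(∑ j : {i : Fin n // e i ∉ slowModes L θ}, (1 - ε) * riccati (t * ‖covCurl (abelianCfg L θ) (e j)‖ ^ 2) b * ⟪e (j : Fin n), x⟫ ^ 2))) *
        ∫ w : {i : Fin n // ¬ e i ∉ slowModes L θ} → ℝ,
          Real.exp (-(∑ j : {i : Fin n // ¬ e i ∉ slowModes L θ}, t * ‖covCurl (abelianCfg L θ) (e j)‖ ^ 2 * ⟪e (j : Fin n), x⟫ ^ 2)) *
          Real.exp (-(b * ∑ j : {i : Fin n // ¬ e i ∉ slowModes L θ}, (⟪e (j : Fin n), x⟫ - w j) ^ 2)) *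
          Real.exp (-(∑ j : {i : Fin n // ¬ e i ∉ slowModes L θ}, t * ‖covCurl (abelianCfg L θ) (e j)‖ ^ 2 * w j ^ 2)) * g w :=
        mul_le_mul_of_nonneg_right (mul_le_mul_of_nonneg_right (mul_le_mul hP hG (Real.exp_pos _).le (by positivity)) (Real.exp_pos _).le) hS
    _ = _ := by ring

end Summit.QuantumFields.YangMills.Theorems.FemtoTransferGap.TwoLattice.Toron

end
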